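import Mathlib
import HarnessLib
import HarnessLib.Audit
import Summits.AtomisticToContinuum.Statement
import Literature.MathematicalPhysics.StatisticalMechanics.BarlowStacking

/-!
Route: CrystalEnergyDerivative

CLOSED (retired) 2026-08-15T13:41:28Z by operator:999:1257524 — reason: not-a-thesis: assembly does not conclude the sub-problem Statement — note: D-0027 §2.1 audit (human 2026-08-15: routes that do not decide the summit are removed): the assembly concludes `Literature.MathematicalPhysics.StatisticalMechanics.Crystallization`, not the sub-problem statement; a NEW conforming route may be opened from the same idea (generated `closes : … → _root_. The file is kept as the record of this route; refuted decls are indexed as negative knowledge (`ledger negatives`).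

X (TANGENT / ENERGY-DERIVATIVE ROUTE; realises idea card energy-derivative-positional-order). It
suffices to show that
Lennard-Jones ground states in R^3 have, asymptotically, BOTH the energy per particle AND the pair
statistics of ONE optimal
relaxed hcp crystal hcp(a,h) (in-layer spacing a, layer spacing h, |h/a - sqrt(2/3)| <= 1/400):
 (i')  hcp(a,h) is least among all periodic configurations for e(.) = energyPerParticle
lennardJones, and E(N)/N -> e(hcp(a,h));
 (ii') for every C^2 compactly supported W : R -> R and EVERY sequence of ground states x^N (no
subsequence, no translation),
       N^-1 * Sum_{i<j} W(|x_i - x_j|) = interactionEnergy W x^N / N  ->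
(hcp(a,h)).energyPerParticle W.
Mechanism. N -> E_V(N) is an infimum of functionals linear in V, hence concave in V; testing V_LJ +-
tW on V_LJ-ground states
gives the supergradient sandwich (E_{V+tW}(N)-E_V(N))/(tN) <= interactionEnergy W x^N / N <=
(E_V(N)-E_{V-tW}(N))/(tN) (t>0).
Hence (ii') holds as soon as t -> lim_N E_{V_LJ+tW}(N)/N has NO CORNER at t = 0 with slope
e_{hcp(a,h)}(W); and no-corner follows
by Danskin on the compact two-parameter hcp family from (C1) directionally robust energetic
crystallization onto that family
(slack eps*|t|) and (C3) uniqueness of the optimal (a,h). Positions then follow from pair statistics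
alone: limits of ground
states around defect-free balls have EXACTLY hcp's distance spectrum and twelve first neighbours,
and (C2) hcp is spectrally
rigid (a twelve-coordinated point set all of whose pair distances are hcp pair distances is an
isometric copy of hcp).
Lean, X = decl Target:
  ∃ (a h : ℝ) (ha : a ≠ 0) (hh : h ≠ 0), 0 < a ∧ |h / a - Real.sqrt (2 / 3)| ≤ 1 / 400 ∧ IsLeast
(Set.range fun Q : PeriodicConfiguration 3 => Q.energyPerParticle lennardJones)
((hcpPeriodicConfiguration ha hh).energyPerParticle lennardJones) ∧ Tendsto (fun N =>
groundStateEnergy lennardJones 3 N / N) atTop (𝓝 ((hcpPeriodicConfiguration ha hh).energyPerParticle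
lennardJones)) ∧ ∀ x, (∀ N, IsGroundState lennardJones (x N)) → ∀ W, ContDiff ℝ 2 W →
HasCompactSupport W → Tendsto (fun N => interactionEnergy W (x N) / N) atTop (𝓝
((hcpPeriodicConfiguration ha hh).energyPerParticle W))
(all constants in Literature.MathematicalPhysics.StatisticalMechanics: Crystallization.lean,
BarlowStacking.lean).
Assembly: Target → SpectralRigidityHcp → GappedKissingBound → LimitTransfer → Crystallization —
conjunct (i) is read off (i');
conjunct (ii) IsCrystallizing lennardJones 3 from (ii') by the potential-free LimitTransfer, fed
with the PROVED uniform
minimal distance LennardJonesMinimalDistance_holds. Target itself: TargetOfCruxes (DanskinStep +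
SupergradientSandwich from
DirectionalRobustHcpBound, UniqueHcpOptimum, TrialUpperBound).

Rationale: WHY THIS LINE. Imported area: convex analysis of the energy as a function of the POTENTIAL (tangent
functionals: Israel 1979;
T=0 Aizenman–Lieb 1981; Radin1984/Radin1987 run "e* concave in V + Mazur" for GENERIC uniqueness of
ground-state measures),
used here in reverse for one potential: pair statistics of ground states are supergradients of V ↦
lim E_V(N)/N, so a
ROBUST (open-along-directions) proof of the energetic conjunct — which is what a certified-margin
proof of (i) delivers anyway —
makes e* differentiable at V_LJ and pins the pair statistics of EVERY ground-state sequence to those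
of the optimal hcp
(BlancLewin2015 §2.1 (16) then costs only geometry). The geometric half is exact, not perturbative:
vague limits around
defect-free balls carry hcp's distance SPECTRUM exactly, so positional order needs a
distance-spectrum rigidity theorem for
hcp (Hales2012/HalesDSP2012 give the ideal-ratio case; homometry — GrimmBaake2008, Senechal2008 — is
why it is a crux) instead
of the robust (η>0, linear-rate) Fejes Tóth–Hales of route CrystalKissingRigidity. No e_loc, no
rates, no fault counting.
Directional (per test function W, compact support) robustness is deliberately the weakest form:
unweighted-norm openness is
false (card crystallization-not-open-weighted-topology: far-shell ripples), and symmetry-breaking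
relaxations beat the
(a,h)-family by o(t) at fixed t, whence the slack ε|t| in C1 (Danskin only needs o(t)).
RANKED CRUXES.
 2. DirectionalRobustHcpBound — ∀ C² compactly supported W, ∀ε, ∃t0, |t|<t0 ⇒ liminf_N
E_{LJ+tW}(N)/N ≥ inf over hcp(a,h),
    (a,h)∈[1/2,2]², of e_{hcp(a,h)}(LJ+tW) − ε|t|. (i) WITH MARGIN; at t=0 it is the lower bound of
(i) with hcp identified.
    Might fail: e* has a corner at V_LJ along some W (two asymptotic ground-state structures with
different pair statistics,
    e.g. exact hcp/fcc or polytype degeneracy: Stillinger2001, PartayOrtnerCsanyi2017 say hcp wins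
by ~1e-4), or (i) fails.
 3. SpectralRigidityHcp — pure discrete geometry: a nonempty set Y ⊂ ℝ³ with all pair distances in
the distance set of
    hcpStacking a h (|h/a−√(2/3)| ≤ 1/400) and exactly 12 points within 6a/5 of each point is g ''
hcpStacking a h.
    Might fail: an exotic twelve-coordinated set with hcp's spectrum (homometric-type switching;
accidental spectral
    coincidences at special ratios h/a re-admitting c-type layers). Ideal ratio:
FejesTothKissingTwelve + (8a² ∉ spec hcp).
 4. UniqueHcpOptimum — certified numerics: (a,h) ↦ e_{hcp(a,h)}(LJ) has a unique minimiser on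
[1/2,2]², with
    |h/a−√(2/3)| ≤ 1/400. Load-bearing for Danskin (uniqueness of the tangent). Might fail only if
the hcp optimum is
    degenerate or its c/a leaves the ±0.3% window (literature deviation ~1e-4: Stillinger2001);
interval arithmetic must
    control the r⁻⁶ tail over the whole box.
SUPPORT (rank 9): TrialUpperBound (E(N)/N ≤ e(Q)+ε eventually, each periodic Q); GappedKissingBound
(≤ 12 points at
distance 1±1/200 from a centre with mutual distances 1±1/200 or ≥ √2−1/100; 45°-cap
inclusion–exclusion, or two lines from
flyspeck_L12); DanskinStep; SupergradientSandwich; TargetOfCruxes (glue); LimitTransfer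
(potential-free: hcp pair statistics
+ uniform separation ⇒ Blanc–Lewin local convergence: pigeonhole for defect-free balls,
GappedKissingBound on 2-good
particles, SpectralRigidityHcp on the limit set,
PeriodicConfiguration.tendsto_sum_of_eventually_near).
KILL CRITERIA. A corner: numerics (nested sampling of bulk LJ, PartayOrtnerCsanyi2017) exhibiting W
with D⁺(W) < D⁻(W)
kills C1 and casts doubt on (ii) itself ⇒ close route. A counterexample to C2 inside the window ⇒
restate C2 at the
certified (a*,h*) or fall back to a two-radius Hales classification (route survives once). C3 false
⇒ restate the window.
Refutation of shared 0627 (periodic minimum not attained) kills the conjunct for every route.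
NOT DECOMPOSED YET (second layer, after a crux moves): C1 = local optimality certificate + locking
gap (0716/0737/0670) +
phonon stability of hcp; C2 = gapped shell classification (non-contact angles ≥ ~90° > Hales's 78°)
+ layer propagation;
the ideal-ratio special case of C2 as a --supports lemma from FejesTothKissingTwelve; the free
instances of the transfer
(2-D: interior of Theil2006's class ⇒ IsCrystallizing V 2; 8-D: E8 via universal optimality
arXiv:1902.05438) — other
dimensions, tests of SupergradientSandwich+LimitTransfer, not items. Sources: BlancLewin2015,
Radin1984, Radin1987, Hales2012,
HalesDSP2012, MusinTarasov2012, Stillinger2001, PartayOrtnerCsanyi2017, GrimmBaake2008,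
Senechal2008, Theil2006, FlatleyTheil2015.

Novelty: NOVELTY (searched 2026-08-15: card's audited priors re-used — refuter-novelty-audit-14 confirmed
new-combination; this session:
lit frontier/bridges AtomisticToContinuum (only arXiv:2407.20762 touches crystallization, d=2),
zbMATH "homometric point sets"
(Senechal2008 doi:10.1016/j.ejc.2008.01.013, GrimmBaake2008 doi:10.1524/zkri.2008.1043, Zobetz 1993,
Patterson 1944 via
Iglesias 1981), zbMATH "strong thirteen spheres" (MusinTarasov2012 arXiv:1002.1439); local hybrid
index; OpenAlex/S2/arXiv
rate-limited (429), plain searchd connection-reset — remote sweep for "differentiability of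
ground-state energy w.r.t. the
pair potential" still owed, as on the card).
Nearest prior art. CONVEX HALF: tangent functionals / differentiability ⇔ uniqueness at T>0 (Israel
1979, Convexity in the
theory of lattice gases); T=0 degeneracy via tangent functionals (Aizenman–Lieb 1981, J. Stat. Phys.
24); "e* concave in V +
Mazur ⇒ GENERIC uniqueness of ground-state measures" (Radin1984 doi:10.1007/bf01017368, Radin1987
doi:10.1142/s0217979287001675;
zero-temperature limits BellissardRadinShlosman2010). GEOMETRIC HALF: Hales2012 (arXiv:1209.6043)
Thm 1 + HalesDSP2012 §1.3
(kissing-twelve packings are Barlow; in tree as FejesTothKissingTwelve with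
HalesDSP_layerPackings_holds discharged),
MusinTarasov2012 (strong thirteen spheres); homometry (Patterson 1944; GrimmBaake2008; Senechal2008)
= pair statistics do
NOT determine structure in general. IN-HOUSE: CrystalKissingRigidity (robust η>0 Fejes Tóth–H  [refs: 10.1016/j.ejc.2008.01.013, 10.1524/zkri.2008.1043, 10.1007/bf01017368, 10.1142/s0217979287001675, 2407.20762, 1002.1439, 1209.6043, doi:10.1016/j.ejc.2008.01.013, doi:10.1524/zkri.2008.1043, doi:10.1007/bf01017368, doi:10.1142/s0217979287001675, Senechal2008, GrimmBaake2008, MusinTarasov2012, Radin1984, Radin1987, BellissardRadinShlosman2010, Hales2012, HalesDSP2012, BlancLewin2015]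

Barriers (technique_class: concavity-in-potential Danskin distance-spectrum-rigidity): technique_class: concavity-in-potential Danskin distance-spectrum-rigidity
- Literature.Barriers.AtomisticToContinuum.KissingTwelveDegeneracy: APPLIES to any contact-only
reading (twelve contacts never fix the stacking; spikeHagg witnesses). Evaded: the stacking is read
from the DISTANCE SPECTRUM beyond contacts — d² = 8a² (k=2 layer pairs with different letters)
occurs iff some layer is c-type and is not an hcp distance; for non-ideal h/a the fcc-type shell
itself carries the forbidden distance √(4h²+a²/3). The spectrum is pinned by C1 through the r⁻⁶ tail
(the energy, not the geometry, selects hcp).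
- Literature.Barriers.AtomisticToContinuum.ShortRangeStackingBlindness: APPLIES to C1
(ShortRangeStackingBlindness_holds: anything blind beyond √(8/3) cannot separate stackings). Not
evaded, isolated: C1 is stated for the full Lennard-Jones tail and inherits the locking-gap
requirement (items 0716/0737/0670 of the sibling routes); test functions W are compactly supported
but the POTENTIAL is never truncated.
- Literature.Barriers.AtomisticToContinuum.FlexibleKissingArrangements: APPLIES to single soft
shells (icosahedral witness 1/40-far from fcc/hcp). Evaded: C2/LimitTransfer never look at one soft
shell — in the limit set EVERY point is exactly twelve-coordinated with all mutual distances in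
hcp's discrete spectrum (icosahedral mutual distance 1.0515a is not an hcp distance), and no rate is
claimed (compactness, not stability).
- Literature.Barriers.AtomisticToContinuum.Icosah

Novelty grade: new-combination — ROUTE REVIEW (refuter rreview g2, 2026-08-15). Novelty NOT re-searched: grade = card audit refuter-14 (new-combination). Route found CLOSED(retired) 13:41Z for assembly conformance only (Statement = abbrev of Literature..Crystallization; fix syntactic). CRUXES 3686-3688 (closed moot, re-filable verb (refuter refuter-rreview-route-AtomisticToContinu-8d156edd-g2-0, 2026-08-15T14:40:50Z; prior: Israel 1979; Aizenman-Lieb 1981 doi:10.1007/BF01942064; Radin1984 doi:10.1007/bf01017368; Radin1987 doi:10.1142/s0217979287001675; Hales2012 arXiv:1209.6043; HalesDSP2012; MusinTarasov2012 arXiv:1002.1439; GrimmBaake2008; Senechal2008; BlancLewin2015 (inherited from card audit refuter-14))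

History (route lifecycle, newest last):
- 2026-08-15T13:41:28Z · CLOSED retired — not-a-thesis: assembly does not conclude the sub-problem Statement (operator:999:1257524)

sub-problem: Crystallization · status: closed(retired) · opened planner-plancard-AtomisticToContinuum-Crystal-c4ec918e-0 2026-08-15T11:23:08Z · rev 0 · ledger route-AtomisticToContinuum-CrystalEnergyDerivative
GENERATED by the gate from the ledger (D-0016/17). Provers cite these decls: `theorem foo : Summit.AtomisticToContinuum.Crystallization.Theses.CrystalEnergyDerivative.<Decl> := …` in Summits/AtomisticToContinuum/Crystallization/Theorems/<Name>.lean.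
-/

namespace Summit.AtomisticToContinuum.Crystallization.Theses.CrystalEnergyDerivative

open scoped BigOperators Topology Manifold Classical MeasureTheory ProbabilityTheory Matrix InnerProductSpace ComplexConjugate ContinuousMap
open Filter Set Function TopologicalSpace MeasureTheory

attribute [summit_statement] _root_.Crystallization

/-- item stmt-AtomisticToContinuum-3685 · target · rank 0 · closed · moot by None · by planner
why it might fail: Fails iff e*(V)=lim E_V(N)/N has a corner at V_LJ along some bump W (two asymptotic ground-state structures with different pair statistics), or (i) fails / is attained off the relaxed-hcp family.
sources: BlancLewin2015 arXiv:1504.01153 §2.1 (15)-(18), §2.3, Radin1987 doi:10.1142/s0217979287001675 (concavity in V, generic uniqueness), Stillinger2001 (hcp below fcc by ~1e-4 for LJ lattice sums), PartayOrtnerCsanyi2017 arXiv:1705.01751 (hcp ground state of full LJ; polytypes only for truncations)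
[target] X: there is one relaxed hcp crystal hcp(a,h), |h/a−√(2/3)| ≤ 1/400, such that (i') it is
least among periodic configurations for the LJ energy per particle and E(N)/N → e(hcp(a,h)), and
(ii') for every C² compactly supported W and EVERY sequence of LJ ground states,
N⁻¹Σ_{i<j}W(|x_i−x_j|) → (hcp(a,h)).energyPerParticle W (pair statistics converge to hcp's, full
sequence, no translations). Obtained from the cruxes by TargetOfCruxes (DanskinStep +
SupergradientSandwich). Why it might fail: as C1 (a corner of e* at V_LJ). Sources: BlancLewin2015
§2.1, §2.3; Radin1987; Stillinger2001. -/
@[route_item "route-AtomisticToContinuum-CrystalEnergyDerivative"]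
def Target : Prop :=
  ∃ (a h : ℝ) (ha : a ≠ 0) (hh : h ≠ 0), 0 < a ∧ |h / a - Real.sqrt (2 / 3)| ≤ 1 / 400 ∧ IsLeast (Set.range fun Q : Literature.MathematicalPhysics.StatisticalMechanics.PeriodicConfiguration 3 => Q.energyPerParticle Literature.MathematicalPhysics.StatisticalMechanics.lennardJones) ((Literature.MathematicalPhysics.StatisticalMechanics.hcpPeriodicConfiguration ha hh).energyPerParticle Literature.MathematicalPhysics.StatisticalMechanics.lennardJones) ∧ Filter.Tendsto (fun N : ℕ => Literature.MathematicalPhysics.StatisticalMechanics.groundStateEnergy Literature.MathematicalPhysics.StatisticalMechanics.lennardJones 3 N / N) Filter.atTop (nhds ((Literature.MathematicalPhysics.StatisticalMechanics.hcpPeriodicConfiguration ha hh).energyPerParticle Literature.MathematicalPhysics.StatisticalMechanics.lennardJones)) ∧ ∀ x : (N : ℕ) → (Fin N → EuclideanSpace ℝ (Fin 3)), (∀ N, Literature.MathematicalPhysics.StatisticalMechanics.IsGroundState Literature.MathematicalPhysics.StatisticalMechanics.lennardJones (x N)) → ∀ W : ℝ → ℝ, ContDiff ℝ 2 W → HasCompactSupport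 W → Filter.Tendsto (fun N : ℕ => Literature.MathematicalPhysics.StatisticalMechanics.interactionEnergy W (x N) / N) Filter.atTop (nhds ((Literature.MathematicalPhysics.StatisticalMechanics.hcpPeriodicConfiguration ha hh).energyPerParticle W))

/-- item stmt-AtomisticToContinuum-3686 · crux · rank 2 · closed · moot by None · by planner
why it might fail: e* may have a corner at V_LJ along some W: hcp/fcc/polytypes are only ~1e-4 apart numerically (uncertified) and the locking gap |J2|>Σk|J_k| (0670) is unproved; at t=0 it is already the open lower bound of (i) with hcp identified.
sources: BlancLewin2015 arXiv:1504.01153 §2.3 ('completely open in dimension three'), Stillinger2001 (LJ lattice sums: hcp vs fcc ~1e-4), PartayOrtnerCsanyi2017 arXiv:1705.01751 p.4 (hcp at zero pressure; hc/hhc polytypes near the boundary for truncated LJ), FlatleyTheil2015 arXiv:1407.0692 Thm 1.1 (fcc energy theorem with three-body term), stmt-AtomisticToContinuum-0716/0737/0670 (Hägg domination / certified J_k, open), card crystallization-not-open-weighted-topology (why only directional robustness can hold)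
[crux] (C1) DIRECTIONALLY ROBUST ENERGETIC CRYSTALLIZATION ONTO THE hcp FAMILY: for every C²
compactly supported W : ℝ → ℝ and every ε > 0 there is t0 > 0 such that for |t| < t0, eventually in
N, E_{LJ+tW}(N)/N ≥ inf over (a,h) ∈ [1/2,2]² of e_{hcp(a,h)}(LJ+tW) − ε|t| (written with an
existential (a,h) in the box). At t = 0 this is the lower bound of conjunct (i) with the minimiser
identified as a relaxed hcp; for t ≠ 0 it is (i) WITH MARGIN along one direction. The slack ε|t| is
necessary (symmetry-breaking relaxations beat the two-parameter family by o(t); O(t²) for C² W by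
transverse isotropy of orbit second moments) and sufficient for Danskin. Directional form evades the
non-openness of Crystallization in unweighted topologies (card
crystallization-not-open-weighted-topology): a compactly supported W moves finitely many interlayer
couplings, t0(W) ~ locking gap/(width × shell index). Why it might fail: e* has a corner at V_LJ
along some W (exact degeneracy of hcp with fcc/polytypes or a non-close-packed competitor; numerics
say hcp wins by ~1e-4), or (i) itself fails. Sources: BlancLewin2015 §2.3; Stillinger2001;
PartayOrtnerCsanyi2017; FlatleyTheil2015 (nearest 3-D energy theo -/
@[route_item "route-AtomisticToContinuum-CrystalEnergyDerivative"]
def DirectionalRobustHcpBound : Prop :=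
  ∀ W : ℝ → ℝ, ContDiff ℝ 2 W → HasCompactSupport W → ∀ ε : ℝ, 0 < ε → ∃ t₀ : ℝ, 0 < t₀ ∧ ∀ t : ℝ, |t| < t₀ → ∀ᶠ N : ℕ in Filter.atTop, ∃ (a h : ℝ) (ha : a ≠ 0) (hh : h ≠ 0), a ∈ Set.Icc (1 / 2 : ℝ) 2 ∧ h ∈ Set.Icc (1 / 2 : ℝ) 2 ∧ (Literature.MathematicalPhysics.StatisticalMechanics.hcpPeriodicConfiguration ha hh).energyPerParticle (fun r => Literature.MathematicalPhysics.StatisticalMechanics.lennardJones r + t * W r) - ε * |t| ≤ Literature.MathematicalPhysics.StatisticalMechanics.groundStateEnergy (fun r => Literature.MathematicalPhysics.StatisticalMechanics.lennardJones r + t * W r) 3 N / N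

/-- item stmt-AtomisticToContinuum-3687 · crux · rank 3 · closed · moot by None · by planner
why it might fail: An exotic 12-coordinated non-hcp set realising only hcp distances (homometric-type switching: pair data do not fix structure in general), or a spectral coincidence at some h/a in the ±1/400 window re-admitting c-type layers; gapped-shell classification unproved.
sources: Hales2012 arXiv:1209.6043 Thm 1, Thm 3, Lemmas 9-10 (class 𝒱: non-contact ≥ 2.52; in tree Literature.Geometry.DiscreteGeometry.FejesTothKissingTwelve / Hales2012_kissingConfigCongruent), HalesDSP2012 §1.3 (fcc/hcp shells ⇒ Barlow; HalesDSP_layerPackings_holds in LayerStackings.lean), GrimmBaake2008 doi:10.1524/zkri.2008.1043 and Senechal2008 doi:10.1016/j.ejc.2008.01.013 (homometric point sets), MusinTarasov2012 arXiv:1002.1439 (strong thirteen spheres; Tammes-13 margin), KusnerKusnerLagariasShlosman2018 arXiv:1611.10297 (flexibility of single kissing shells), Literature.Barriers.AtomisticToContinuum.KissingTwelveDegeneracy (contacts alone never fix the stacking)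
[crux] (C2) DISTANCE-SPECTRUM RIGIDITY OF hcp (pure discrete geometry, no potential): for 0 < a and
|h/a − √(2/3)| ≤ 1/400, every nonempty Y ⊂ ℝ³ whose pair distances all belong to the distance set of
hcpStacking a h and in which every point has exactly 12 points of Y within 6a/5 is g '' hcpStacking
a h for an isometry g. Content: (1) shell classification — 12 points at radii {a, a'} (split ≤ 0.2%)
with mutual distances in the spectrum, hence contacts at ~60° and NON-contacts at ≥ ~90° (second hcp
distance ≈ √2·a), a gap wider than Hales's class 𝒱 (78°), so cuboctahedral/anticuboctahedral shells
should follow synthetically (≤ 4 contacts by azimuth counting 70.5°/109.5°, inclusion–exclusion of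
45° caps); (2) stacking selection by the spectrum — for non-ideal h the fcc-type shell contains the
forbidden distance √(4h²+a²/3); for ideal h the k=2 pair distance 2√2·a occurs iff some layer is
c-type and 8 ∉ spec(hcp) (8 not Löschian, 22/3 ∉ L'); (3) propagation layer by layer (as
HalesDSP_layerPackings_holds, LayerStackings.lean). Ideal-ratio special case =
FejesTothKissingTwelve (tree; mod flyspeck_L12 + Hales2012_contactGraphTame) + (2). Why it might
fail: an exotic twelve-coordinated s -/
@[route_item "route-AtomisticToContinuum-CrystalEnergyDerivative"]
def SpectralRigidityHcp : Prop :=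
  ∀ a h : ℝ, 0 < a → |h / a - Real.sqrt (2 / 3)| ≤ 1 / 400 → ∀ Y : Set (EuclideanSpace ℝ (Fin 3)), Y.Nonempty → (∀ y ∈ Y, ∀ y' ∈ Y, y ≠ y' → ∃ p ∈ Literature.MathematicalPhysics.StatisticalMechanics.hcpStacking a h, ∃ q ∈ Literature.MathematicalPhysics.StatisticalMechanics.hcpStacking a h, dist y y' = dist p q) → (∀ y ∈ Y, {y' ∈ Y | y' ≠ y ∧ dist y y' ≤ 6 / 5 * a}.ncard = 12) → ∃ g : EuclideanSpace ℝ (Fin 3) ≃ᵢ EuclideanSpace ℝ (Fin 3), Y = g '' Literature.MathematicalPhysics.StatisticalMechanics.hcpStacking a h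

/-- item stmt-AtomisticToContinuum-3688 · crux · rank 4 · closed · moot by None · by planner
why it might fail: False only if the hcp optimum of the LJ lattice sum on [1/2,2]² is degenerate (two minimisers / flat direction) or its c/a deviates from ideal by > 1/400 (literature ~1e-4, uncertified); tail and box boundary must be certified.
sources: Stillinger2001 (J. Chem. Phys. 115:5208; hcp/fcc LJ lattice sums, relaxed c/a), BeterminPetrache2019 (optimal and non-optimal lattices for non-completely-monotone potentials), PartayOrtnerCsanyi2017 arXiv:1705.01751, card motif-ladder-scale-free-quotient (certified 2x2 Hessian, shared H4)
[crux] (C3) CERTIFIED UNIQUENESS OF THE OPTIMAL RELAXED hcp: the map (a,h) ↦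
(hcpPeriodicConfiguration a h).energyPerParticle lennardJones has a unique minimiser (a0,h0) on the
box [1/2,2]², and |h0/a0 − √(2/3)| ≤ 1/400 (expected a0 ≈ 0.971, c/a − ideal ~ 1e-4). Load-bearing
for the Danskin step (uniqueness of the tangent = differentiability of the min over the family) and
it places (a0,h0) inside C2's window. Method: interval arithmetic on the hcp lattice sums with a
rigorous r⁻⁶ tail bound, branch-and-bound over the box, positive-definite Hessian enclosure near the
minimiser (shared in substance with card motif-ladder-scale-free-quotient's H4). Why it might fail:
only if the optimum is degenerate (a flat direction / two minima) or its c/a leaves the ±0.3%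
window; the tail and the box corners (stretched/compressed hcp) must be controlled rigorously.
Sources: Stillinger2001; BeterminPetrache2019 (lattice energies for LJ-type potentials);
PartayOrtnerCsanyi2017. -/
@[route_item "route-AtomisticToContinuum-CrystalEnergyDerivative"]
def UniqueHcpOptimum : Prop :=
  ∃ (a₀ h₀ : ℝ) (ha₀ : a₀ ≠ 0) (hh₀ : h₀ ≠ 0), a₀ ∈ Set.Icc (1 / 2 : ℝ) 2 ∧ h₀ ∈ Set.Icc (1 / 2 : ℝ) 2 ∧ |h₀ / a₀ - Real.sqrt (2 / 3)| ≤ 1 / 400 ∧ ∀ (a h : ℝ) (ha : a ≠ 0) (hh : h ≠ 0), a ∈ Set.Icc (1 / 2 : ℝ) 2 → h ∈ Set.Icc (1 / 2 : ℝ) 2 → (Literature.MathematicalPhysics.StatisticalMechanics.hcpPeriodicConfiguration ha₀ hh₀).energyPerParticle Literature.MathematicalPhysics.StatisticalMechanics.lennardJones ≤ (Literature.MathematicalPhysics.StatisticalMechanics.hcpPeriodicConfiguration ha hh).energyPerParticle Literature.MathematicalPhysics.StatisticalMechanics.lennardJones ∧ ((Literature.MathematicalPhysics.StatisticalMechanics.hcpPeriodicConfiguration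 ha hh).energyPerParticle Literature.MathematicalPhysics.StatisticalMechanics.lennardJones ≤ (Literature.MathematicalPhysics.StatisticalMechanics.hcpPeriodicConfiguration ha₀ hh₀).energyPerParticle Literature.MathematicalPhysics.StatisticalMechanics.lennardJones → a = a₀ ∧ h = h₀)

/-- item stmt-AtomisticToContinuum-3689 · support · rank 9 · closed · moot by None · by planner
[support] TRIAL-STATE UPPER BOUND, one periodic competitor at a time: for every
PeriodicConfiguration Q of ℝ³ and ε > 0, eventually E(N)/N ≤ Q.energyPerParticle lennardJones + ε
(finite blocks Q ∩ B_R with M ≤ N points plus N − M = O(N^{2/3}) far-away particles; the cut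
attractive tail is o(M) by summability of r⁻⁶ in d = 3, cut repulsive pairs only help;
summable_lennardJones_dist_three). Sibling of 0629 (limsup ≤ ⨅) without BddBelow bookkeeping.
Sources: BlancLewin2015 §1.3, §2.1 (23). -/
@[route_item "route-AtomisticToContinuum-CrystalEnergyDerivative"]
def TrialUpperBound : Prop :=
  ∀ Q : Literature.MathematicalPhysics.StatisticalMechanics.PeriodicConfiguration 3, ∀ ε : ℝ, 0 < ε → ∀ᶠ N : ℕ in Filter.atTop, Literature.MathematicalPhysics.StatisticalMechanics.groundStateEnergy Literature.MathematicalPhysics.StatisticalMechanics.lennardJones 3 N / N ≤ Q.energyPerParticle Literature.MathematicalPhysics.StatisticalMechanics.lennardJones + ε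

/-- item stmt-AtomisticToContinuum-3690 · support · rank 9 · closed · moot by None · by planner
[support] GAPPED KISSING BOUND (self-contained, no named fact): at most 12 points lie at distance
within 1/200 of 1 from a centre if their mutual distances are either within 1/200 of 1 or at least
√2 − 1/100. Two proofs: (a) elementary — azimuthal gaps around a point are ~70.5° or ≥ ~109.5°, so ≤
4 contacts per point and contact cliques ≤ 3; inclusion–exclusion for the twelve-plus 45°-caps (area
2π(1−cos45°) each, pairwise overlaps only along contacts) exceeds 4π for 13 points; (b) for whoever
assumes Literature.Geometry.DiscreteGeometry.flyspeck_L12: rescale by 2/0.995, then 13·L(1.01005) =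
13·(1.26−1.01005)/0.26 ≈ 12.5 > 12. Used by LimitTransfer on 2-good particles (first-shell split ≤
0.2% inside the ±1/400 window, second hcp distance ≥ (√2 − 0.0015)a). Sources: Hales2012 Lemma 1
(L12); MusinTarasov2012 (Tammes 13: 57.14°); SchutteVanDerWaerden 1953 / Leech 1956 (kissing number
twelve). -/
@[route_item "route-AtomisticToContinuum-CrystalEnergyDerivative"]
def GappedKissingBound : Prop :=
  ∀ (c : EuclideanSpace ℝ (Fin 3)) (T : Finset (EuclideanSpace ℝ (Fin 3))), (∀ p ∈ T, 199 / 200 ≤ dist p c ∧ dist p c ≤ 201 / 200) → (∀ p ∈ T, ∀ q ∈ T, p ≠ q → (199 / 200 ≤ dist p q ∧ dist p q ≤ 201 / 200) ∨ Real.sqrt 2 - 1 / 100 ≤ dist p q) → T.card ≤ 12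

/-- item stmt-AtomisticToContinuum-3691 · support · rank 9 · closed · moot by None · by planner
[support] DANSKIN STEP: DirectionalRobustHcpBound → UniqueHcpOptimum → TrialUpperBound → ∃ hcp(a,h)
in the window with (i') [IsLeast among periodic configurations + E(N)/N → e(hcp(a,h)), from t = 0
and the trial bound] and NO CORNER of e* along every C² compactly supported W: ∀ ε ∃ t0 ∀ t ∈
(0,t0), eventually (E_{LJ+tW}(N) − E_LJ(N))/(tN) ≥ e_{hcp(a,h)}(W) − ε and (E_LJ(N) −
E_{LJ−tW}(N))/(tN) ≤ e_{hcp(a,h)}(W) + ε. Proof: m(t) = inf_box [e_{hcp}(LJ) + t e_{hcp}(W)]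
(energyPerParticle is linear in V under summability); near-minimisers at small t converge to the
unique (a0,h0) by compactness of the box and continuity of the lattice sums on it, so (m(t) −
m(0))/t → e_{hcp(a0,h0)}(W); combine with C1 (slack ε|t|) and TrialUpperBound at Q = hcp(a0,h0).
Danskin's theorem itself is not in Mathlib; only this one-sided elementary version is needed.
Sources: Danskin 1966 (theory of max-min); BlancLewin2015 §1.3. -/
@[route_item "route-AtomisticToContinuum-CrystalEnergyDerivative"]
def DanskinStep : Prop :=
  DirectionalRobustHcpBound → UniqueHcpOptimum → TrialUpperBound → ∃ (a h : ℝ) (ha : a ≠ 0) (hh : h ≠ 0), 0 < a ∧ |h / a - Real.sqrt (2 / 3)| ≤ 1 / 400 ∧ IsLeast (Set.range fun Q : Literature.MathematicalPhysics.StatisticalMechanics.PeriodicConfiguration 3 => Q.energyPerParticle Literature.MathematicalPhysics.StatisticalMechanics.lennardJones) ((Literature.MathematicalPhysics.StatisticalMechanics.hcpPeriodicConfiguration ha hh).energyPerParticle Literature.MathematicalPhysics.StatisticalMechanics.lennardJones) ∧ Filter.Tendsto (fun N : ℕ => Literature.MathematicalPhysics.StatisticalMechanics.groundStateEnergy Literature.MathematicalPhysics.StatisticalMechanics.lennardJones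 3 N / N) Filter.atTop (nhds ((Literature.MathematicalPhysics.StatisticalMechanics.hcpPeriodicConfiguration ha hh).energyPerParticle Literature.MathematicalPhysics.StatisticalMechanics.lennardJones)) ∧ ∀ W : ℝ → ℝ, ContDiff ℝ 2 W → HasCompactSupport W → ∀ ε : ℝ, 0 < ε → ∃ t₀ : ℝ, 0 < t₀ ∧ ∀ t : ℝ, 0 < t → t < t₀ → (∀ᶠ N : ℕ in Filter.atTop, (Literature.MathematicalPhysics.StatisticalMechanics.hcpPeriodicConfiguration ha hh).energyPerParticle W - ε ≤ (Literature.MathematicalPhysics.StatisticalMechanics.groundStateEnergy (fun r => Literature.MathematicalPhysics.StatisticalMechanics.lennardJones r + t * W r) 3 N - Literature.MathematicalPhysics.StatisticalMechanics.groundStateEnergy Literature.MathematicalPhysics.StatisticalMechanics.lennardJones 3 N) / (t * (N : ℝ))) ∧ (∀ᶠ N : ℕ in Filter.atTop, (Literature.MathematicalPhysics.StatisticalMechanics.groundStateEnergy Literature.MathematicalPhysics.StatisticalMechanics.lennardJones 3 N - Literature.MathematicalPhysics.StatisticalMechanics.groundStateEnergy (fun r => Literature.MathematicalPhysics.StatisticalMechanics.lennardJones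 r - t * W r) 3 N) / (t * (N : ℝ)) ≤ (Literature.MathematicalPhysics.StatisticalMechanics.hcpPeriodicConfiguration ha hh).energyPerParticle W + ε)

/-- item stmt-AtomisticToContinuum-3692 · support · rank 9 · closed · moot by None · by planner
[support] SUPERGRADIENT SANDWICH (the transfer principle, soft): for any periodic P, NO CORNER of e*
at V_LJ with slope P.energyPerParticle W (both one-sided finite-N clauses) implies that for EVERY
sequence of LJ ground states x^N and every C² compactly supported W, interactionEnergy W x^N / N →
P.energyPerParticle W. Proof: V_LJ + tW is bounded below (W bounded), so E_{LJ+tW}(N) ≤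
𝓔_{LJ+tW}(x^N) = E_LJ(N) + t·𝓔_W(x^N) (groundStateEnergy_le_of_le); divide by tN for t > 0 and use
LJ − tW for the other side; liminf/limsup are squeezed within ε for every ε. This is the T = 0,
single-potential shadow of 'differentiability of the pressure ⇔ unique tangent functional' (Israel
1979; Aizenman–Lieb 1981; Radin1984/Radin1987). Sources: Radin1987; BellissardRadinShlosman2010;
BlancLewin2015 §1.1–1.3. -/
@[route_item "route-AtomisticToContinuum-CrystalEnergyDerivative"]
def SupergradientSandwich : Prop :=
  ∀ P : Literature.MathematicalPhysics.StatisticalMechanics.PeriodicConfiguration 3, (∀ W : ℝ → ℝ, ContDiff ℝ 2 W → HasCompactSupport W → ∀ ε : ℝ, 0 < ε → ∃ t₀ : ℝ, 0 < t₀ ∧ ∀ t : ℝ, 0 < t → t < t₀ → (∀ᶠ N : ℕ in Filter.atTop, P.energyPerParticle W - ε ≤ (Literature.MathematicalPhysics.StatisticalMechanics.groundStateEnergy (fun r => Literature.MathematicalPhysics.StatisticalMechanics.lennardJones r + t * W r) 3 N - Literature.MathematicalPhysics.StatisticalMechanics.groundStateEnergy Literature.MathematicalPhysics.StatisticalMechanics.lennardJones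 3 N) / (t * (N : ℝ))) ∧ (∀ᶠ N : ℕ in Filter.atTop, (Literature.MathematicalPhysics.StatisticalMechanics.groundStateEnergy Literature.MathematicalPhysics.StatisticalMechanics.lennardJones 3 N - Literature.MathematicalPhysics.StatisticalMechanics.groundStateEnergy (fun r => Literature.MathematicalPhysics.StatisticalMechanics.lennardJones r - t * W r) 3 N) / (t * (N : ℝ)) ≤ P.energyPerParticle W + ε)) → ∀ x : (N : ℕ) → (Fin N → EuclideanSpace ℝ (Fin 3)), (∀ N, Literature.MathematicalPhysics.StatisticalMechanics.IsGroundState Literature.MathematicalPhysics.StatisticalMechanics.lennardJones (x N)) → ∀ W : ℝ → ℝ, ContDiff ℝ 2 W → HasCompactSupport W → Filter.Tendsto (fun N : ℕ => Literature.MathematicalPhysics.StatisticalMechanics.interactionEnergy W (x N) / N) Filter.atTop (nhds (P.energyPerParticle W))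

/-- item stmt-AtomisticToContinuum-3693 · support · rank 9 · closed · moot by None · by planner
[support] GLUE: DanskinStep → SupergradientSandwich → DirectionalRobustHcpBound → UniqueHcpOptimum →
TrialUpperBound → Target (apply DanskinStep to get hcp(a,h), the energetic clauses and no-corner;
SupergradientSandwich at P = hcpPeriodicConfiguration turns no-corner into convergence of pair
statistics). Minutes of Lean once the antecedents are decls. -/
@[route_item "route-AtomisticToContinuum-CrystalEnergyDerivative"]
def TargetOfCruxes : Prop :=
  DanskinStep → SupergradientSandwich → DirectionalRobustHcpBound → UniqueHcpOptimum → TrialUpperBound → Target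

/-- item stmt-AtomisticToContinuum-3694 · support · rank 9 · closed · moot by None · by planner
[support] LIMIT TRANSFER (potential-free positional half): SpectralRigidityHcp → GappedKissingBound
→ for hcp(a,h) in the window and ANY sequence of N-point configurations x^N with a uniform minimal
distance δ > 0 whose W-statistics interactionEnergy W x^N / N converge to
(hcp(a,h)).energyPerParticle W for all C² compactly supported W, the Blanc–Lewin conclusion holds:
along a subsequence and after translations the empirical measures converge locally to Σ_{s ∈
P.points} δ_s for a periodic P (an isometric image of hcp, multiplicity 1). Proof sketch: (1) radial
pair measures G_N → G* = Σ n_s δ_{ρ_s} (hcp shells) vaguely on (0,∞) via smooth bumps; (2) zero-mass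
windows (below the first shell, between shells) fail at only o(N) particles — no pointwise bound
needed; (3) first shell: average 12 and, at 2-good particles (all particles within 3a are
window-clean), pointwise ≤ 12 by GappedKissingBound ⇒ exactly 12 at all but o(N); (4) pigeonhole
(defective o(N), good particles δ-separated) gives defect-free balls B(x_{i_N}, R_N), R_N → ∞, with
tolerances δ'_N → 0; (5) translate by −x_{i_N}, extract a locally Hausdorff-convergent subsequence
(uniform discreteness); the limit Y has all distan -/
@[route_item "route-AtomisticToContinuum-CrystalEnergyDerivative"]
def LimitTransfer : Prop :=
  SpectralRigidityHcp → GappedKissingBound → ∀ (a h : ℝ) (ha : a ≠ 0) (hh : h ≠ 0), 0 < a → |h / a - Real.sqrt (2 / 3)| ≤ 1 / 400 → ∀ x : (N : ℕ) → (Fin N → EuclideanSpace ℝ (Fin 3)), (∃ δ : ℝ, 0 < δ ∧ ∀ (N : ℕ) (i j : Fin N), i ≠ j → δ ≤ dist (x N i) (x N j)) → (∀ W : ℝ → ℝ, ContDiff ℝ 2 W → HasCompactSupport W → Filter.Tendsto (fun N : ℕ => Literature.MathematicalPhysics.StatisticalMechanics.interactionEnergy W (x N) / N) Filter.atTop (nhds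 ((Literature.MathematicalPhysics.StatisticalMechanics.hcpPeriodicConfiguration ha hh).energyPerParticle W))) → ∃ (φ : ℕ → ℕ) (τ : ℕ → EuclideanSpace ℝ (Fin 3)) (P : Literature.MathematicalPhysics.StatisticalMechanics.PeriodicConfiguration 3) (m : EuclideanSpace ℝ (Fin 3) → ℕ), StrictMono φ ∧ (∀ s ∈ P.points, 1 ≤ m s) ∧ (∀ g ∈ P.lattice, ∀ s, m (s + g) = m s) ∧ ∀ f : EuclideanSpace ℝ (Fin 3) → ℝ, Continuous f → HasCompactSupport f → Filter.Tendsto (fun j => ∑ i : Fin (φ j), f (x (φ j) i + τ j)) Filter.atTop (nhds (∑' s : P.points, (m s : ℝ) * f s))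

/-- item stmt-AtomisticToContinuum-3695 · assembly · rank 1 · closed · moot by None · by planner
[assembly] Target → SpectralRigidityHcp → GappedKissingBound → LimitTransfer → Crystallization.
Proof: from Target take hcp(a,h); HasPeriodicGroundStateEnergy lennardJones 3 is (i') verbatim
(witness P = hcpPeriodicConfiguration ha hh); IsCrystallizing lennardJones 3: given a ground-state
sequence x, feed LimitTransfer with 0 < a, the window, the uniform minimal distance from
Literature.MathematicalPhysics.StatisticalMechanics.LennardJonesMinimalDistance_holds (PROVED,
LennardJonesClusters.lean) and the pair statistics (ii'). Pure glue. -/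
@[route_item "route-AtomisticToContinuum-CrystalEnergyDerivative"]
def Assembly : Prop :=
  Target → SpectralRigidityHcp → GappedKissingBound → LimitTransfer → Literature.MathematicalPhysics.StatisticalMechanics.Crystallization

end Summit.AtomisticToContinuum.Crystallization.Theses.CrystalEnergyDerivative
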